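import Summits.Schanuel.Schanuel.Theorems.RootDecomp1HWitnessRigid

/-!
# RootDecomp1H — THE TRANSVERSE WITNESS, part 3 of 3 (§7–§10: `W₃` is a non-degenerate Khovanskii point with integer
# coefficients, lies in `𝓒 = ecl ∅`, is star-presentable, and the wall in tower form)

All three parts (`RootDecomp1HWitnessCore` §1–§3, `RootDecomp1HWitnessRigid` §4–§6, `RootDecomp1HWitness` §7–§10) share the
namespace `Summit.Schanuel.Schanuel.Theorems.RootDecomp1HWitness`; importers use the last part.
See part 1 (`RootDecomp1HWitnessCore`) for the full account of the round. lens-5 cell decomp-schanuel g8; `--supports stmt-Schanuel-30564`.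
-/

set_option linter.dupNamespace false

noncomputable section

namespace Summit.Schanuel.Schanuel.Theorems.RootDecomp1HWitness

open Complex Set
open Literature.NumberTheory.Transcendental (exists_nsmul_mem_span_int mem_adjoin_of_mem_span_int ecl Khovanskii.ePD
  Khovanskii.IsSol Khovanskii.kpt Khovanskii.kjac Khovanskii.polyOver Khovanskii.X_mem_polyOver Khovanskii.mem_ecl_iff
  Khovanskii.ePD_map_of_ringHom)
open Summit.Schanuel.Schanuel.Theses.RootDecomp1H (ProductSchanuel RelTowerSchanuel BridgeTransverse)
open Summit.Schanuel.Schanuel.Theorems.RootDecomp1HTowerCells (trdeg_adjoin_adjoin_eq trdeg_adjoin_union_le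
  trdeg_adjoin_range_le)
open Summit.Schanuel.Schanuel.Theorems.RootDecomp1HCurveHull
open Summit.Schanuel.Schanuel.Theorems.RootDecomp1HClearance (InTowerHull)
open Summit.Schanuel.Schanuel.Theorems.RootDecomp1HBlockClearance (trdeg_pairRange_lt_aleph0)

/-- `i` is algebraic over `ℚ` (private copy, see part 1). -/
private theorem isAlgebraic_I : IsAlgebraic ℚ I := by
  refine IsAlgebraic.of_pow (by norm_num : 0 < 2) ?_
  rw [Complex.I_sq]
  exact isAlgebraic_one.neg

/-! ## 7. The witness is a non-degenerate Khovanskii point with integer coefficients -/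

/-- THE KHOVANSKII SYSTEM OF THE WITNESS (coefficients `0, ±1`, total degree `2`):
`y₁·y₁ − y₀·y₀ − y₀·y₀ = 0`, `y₂·y₂ + y₀·y₀ = 0`, `e^{y₁} − e^{y₀} − 1 = 0`. -/
def gW (R : Type*) [CommRing R] : Fin 3 → MvPolynomial (Fin 3 ⊕ Fin 3) R :=
  ![MvPolynomial.X (Sum.inl 1) * MvPolynomial.X (Sum.inl 1) - MvPolynomial.X (Sum.inl 0) * MvPolynomial.X (Sum.inl 0) -
      MvPolynomial.X (Sum.inl 0) * MvPolynomial.X (Sum.inl 0),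
    MvPolynomial.X (Sum.inl 2) * MvPolynomial.X (Sum.inl 2) + MvPolynomial.X (Sum.inl 0) * MvPolynomial.X (Sum.inl 0),
    MvPolynomial.X (Sum.inr 1) - MvPolynomial.X (Sum.inr 0) - 1]

/-- `√2 · √2 = 2` in `ℂ`. -/
theorem rt2_mul_rt2 : rt2 * rt2 = 2 := by rw [← sq, rt2_sq]

/-- The real number `(2 − √2)·e^{a₀} + 2` is positive, so non-zero in `ℂ`. -/
theorem key_ne_zero : (2 - rt2) * E + 2 ≠ 0 := by
  have hs : Real.sqrt 2 < 2 := by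
    rw [show (2 : ℝ) = Real.sqrt 4 by rw [show (4 : ℝ) = 2 ^ 2 by norm_num, Real.sqrt_sq (by norm_num : (0:ℝ) ≤ 2)]]
    exact Real.sqrt_lt_sqrt (by norm_num) (by norm_num)
  have hpos : 0 < (2 - Real.sqrt 2) * Real.exp a₀ + 2 := by
    have := Real.exp_pos a₀
    nlinarith
  have h : (2 - rt2) * E + 2 = (((2 - Real.sqrt 2) * Real.exp a₀ + 2 : ℝ) : ℂ) := by
    unfold rt2 E; push_cast; ring
  rw [h]
  exact Complex.ofReal_ne_zero.2 hpos.ne'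

/-- `W₃` solves its Khovanskii system. -/
theorem aeval_gW (i : Fin 3) : MvPolynomial.aeval (Sum.elim W₃ (cexp ∘ W₃)) (gW ℚ i) = 0 := by
  fin_cases i
  · simp only [gW, Fin.zero_eta, Matrix.cons_val_zero, map_sub, map_mul, MvPolynomial.aeval_X, Sum.elim_inl, W₃_one,
      W₃_zero]
    linear_combination (↑a₀ * ↑a₀ : ℂ) * rt2_mul_rt2
  · simp only [gW, Fin.mk_one, Matrix.cons_val_one, Matrix.cons_val_zero, map_add, map_mul, MvPolynomial.aeval_X,
      Sum.elim_inl, W₃_two, W₃_zero]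
    linear_combination (↑a₀ * ↑a₀ : ℂ) * Complex.I_mul_I
  · simp only [gW, Fin.reduceFinMk, Matrix.cons_val, map_sub, map_one, MvPolynomial.aeval_X, Sum.elim_inr,
      Function.comp_apply, W₃_one, W₃_zero]
    rw [show cexp (rt2 * ↑a₀) = D from rfl, show cexp (↑a₀ : ℂ) = E from rfl, D_eq]
    ring

/-- The exponential Jacobian of the system at `W₃`. -/
theorem jacobian_gW : (Matrix.of fun i j => MvPolynomial.aeval (Sum.elim W₃ (cexp ∘ W₃)) (Khovanskii.ePD j (gW ℚ i))) =
    !![-4 * (a₀ : ℂ), 2 * rt2 * a₀, 0; 2 * a₀, 0, 2 * I * a₀; -E, D, 0] := by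
  ext i j
  fin_cases i <;> fin_cases j <;>
    simp [gW, Khovanskii.ePD, MvPolynomial.pderiv_X, Matrix.of_apply, E, D] <;> ring_nf

/-- Its determinant: `4 i a₀² ((2 − √2) E + 2) ≠ 0`. -/
theorem det_jacobian_gW :
    (Matrix.of fun i j => MvPolynomial.aeval (Sum.elim W₃ (cexp ∘ W₃)) (Khovanskii.ePD j (gW ℚ i))).det =
      4 * I * (a₀ : ℂ) ^ 2 * ((2 - rt2) * E + 2) := by
  rw [jacobian_gW, Matrix.det_fin_three]
  simp only [Matrix.of_apply, Matrix.cons_val', Matrix.cons_val_zero, Matrix.cons_val_one, Matrix.cons_val_two,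
    Matrix.empty_val', Matrix.cons_val_fin_one, Matrix.head_cons, Matrix.tail_cons, Matrix.head_fin_const]
  rw [D_eq]
  ring

/-- **THE WITNESS IS A NON-DEGENERATE KHOVANSKII POINT** (the `∃ g` clause of `BridgeTransverse`'s star-optimality hypothesis,
without the complexity book-keeping): a rational Khovanskii system vanishing at `(W₃, e^{W₃})` with non-zero exponential Jacobian. -/
theorem khovanskii_certificate : ∃ g : Fin 3 → MvPolynomial (Fin 3 ⊕ Fin 3) ℚ,
    (∀ i, MvPolynomial.aeval (Sum.elim W₃ (cexp ∘ W₃)) (g i) = 0) ∧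
      (Matrix.of fun i j => MvPolynomial.aeval (Sum.elim W₃ (cexp ∘ W₃)) (Khovanskii.ePD j (g i))).det ≠ 0 := by
  refine ⟨gW ℚ, aeval_gW, ?_⟩
  rw [det_jacobian_gW]
  exact mul_ne_zero (mul_ne_zero (mul_ne_zero (by norm_num) Complex.I_ne_zero) (pow_ne_zero 2 a₀_ne_zero)) key_ne_zero

/-! ## 8. The witness lies in `𝓒 = ecl ∅` -/

/-- The system `gW` over `ℂ` is the base change of `gW` over `ℚ`. -/
theorem gW_map (i : Fin 3) : gW ℂ i = MvPolynomial.map (algebraMap ℚ ℂ) (gW ℚ i) := by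
  fin_cases i <;> simp [gW, MvPolynomial.map_X]

/-- The Khovanskii point of `W₃` is `(W₃, e^{W₃})`. -/
theorem kpt_W₃ : Khovanskii.kpt W₃ = Sum.elim W₃ (cexp ∘ W₃) := rfl

/-- Evaluating the base change to `ℂ` of a rational polynomial at the Khovanskii point of `W₃` is `aeval`. -/
theorem eval_map_eq_aeval (p : MvPolynomial (Fin 3 ⊕ Fin 3) ℚ) :
    MvPolynomial.eval (Sum.elim W₃ (cexp ∘ W₃)) (MvPolynomial.map (algebraMap ℚ ℂ) p) =
      MvPolynomial.aeval (Sum.elim W₃ (cexp ∘ W₃)) p := by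
  rw [MvPolynomial.eval_map, MvPolynomial.aeval_def]

/-- `W₃` is a solution of its Khovanskii system in the format of `Literature.NumberTheory.Transcendental.ecl` (coefficients in the
prime ring, vanishing, non-zero exponential Jacobian). -/
theorem isSol_W₃ : Khovanskii.IsSol (∅ : Set ℂ) W₃ (gW ℂ) := by
  classical
  refine ⟨?_, ?_, ?_⟩
  · intro i
    fin_cases i
    · simp only [gW, Fin.zero_eta, Matrix.cons_val_zero]
      exact sub_mem (sub_mem (mul_mem (Khovanskii.X_mem_polyOver _ _) (Khovanskii.X_mem_polyOver _ _))
        (mul_mem (Khovanskii.X_mem_polyOver _ _) (Khovanskii.X_mem_polyOver _ _))) (mul_mem (Khovanskii.X_mem_polyOver _ _) (Khovanskii.X_mem_polyOver _ _))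
    · simp only [gW, Fin.mk_one, Matrix.cons_val_one, Matrix.cons_val_zero]
      exact add_mem (mul_mem (Khovanskii.X_mem_polyOver _ _) (Khovanskii.X_mem_polyOver _ _)) (mul_mem (Khovanskii.X_mem_polyOver _ _) (Khovanskii.X_mem_polyOver _ _))
    · simp only [gW, Fin.reduceFinMk, Matrix.cons_val]
      exact sub_mem (sub_mem (Khovanskii.X_mem_polyOver _ _) (Khovanskii.X_mem_polyOver _ _)) (one_mem _)
  · intro i
    rw [kpt_W₃, gW_map, eval_map_eq_aeval]
    exact aeval_gW i
  · have hJ : Khovanskii.kjac W₃ (gW ℂ) =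
        Matrix.of fun i j => MvPolynomial.aeval (Sum.elim W₃ (cexp ∘ W₃)) (Khovanskii.ePD j (gW ℚ i)) := by
      ext i j
      simp only [Khovanskii.kjac, Matrix.of_apply, kpt_W₃, gW_map, Khovanskii.ePD_map_of_ringHom, eval_map_eq_aeval]
    rw [hJ, det_jacobian_gW]
    exact mul_ne_zero (mul_ne_zero (mul_ne_zero (by norm_num) Complex.I_ne_zero) (pow_ne_zero 2 a₀_ne_zero)) key_ne_zero

/-- **THE WITNESS LIES IN `𝓒 = ecl ∅`**, coordinate-wise: the countable exponentially-algebraically closed field to which 1J's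
localisation (`EclStarReduction`) confines every first failure of Schanuel's conjecture. -/
theorem W₃_mem_ecl (j : Fin 3) : W₃ j ∈ ecl (∅ : Set ℂ) := by
  classical
  exact Khovanskii.mem_ecl_iff.2 ⟨Fin 3, inferInstance, inferInstance, W₃, gW ℂ, isSol_W₃, j, rfl⟩

/-- `a₀ ∈ 𝓒 = ecl ∅`. -/
theorem a₀_mem_ecl : (a₀ : ℂ) ∈ ecl (∅ : Set ℂ) := W₃_mem_ecl 0

/-- **DICHOTOMY.**  Under Schanuel on the hull, `𝓒 = ecl ∅` is NOT contained in the hull `𝓚`: the residual's ambient field has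
points off `𝓚` (namely `a₀`).  Contrapositively: `ecl ∅ ⊆ 𝓚` refutes `ProductSchanuel ∧ RelTowerSchanuel`, hence Schanuel. -/
theorem ecl_not_subset_curveHull (hS : SchanuelOn curveHull) : ¬ (ecl (∅ : Set ℂ) ⊆ (↑curveHull : Set ℂ)) := fun h =>
  a₀_not_mem_curveHull hS (h a₀_mem_ecl)

/-- Under Schanuel's conjecture, `𝓒 = ecl ∅` is not contained in the curve hull `𝓚`. -/
theorem ecl_not_subset_curveHull_of_schanuel (h : _root_.Schanuel) : ¬ (ecl (∅ : Set ℂ) ⊆ (↑curveHull : Set ℂ)) :=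
  ecl_not_subset_curveHull (schanuelOn_curveHull_of_schanuel h)

/-! ## 9. Star-presentability: the first inline hypothesis of `BridgeTransverse` at `y = W₃` -/

/-- The complexity of the system is `≤ 2` (total degree `2`, coefficients `0, ±1, −2`). -/
theorem complexity_gW (i : Fin 3) :
    max (gW ℚ i).totalDegree ((gW ℚ i).support.sup fun m => max ((gW ℚ i).coeff m).num.natAbs ((gW ℚ i).coeff m).den) ≤ 2 := by
  classical
  have hXX : ∀ s : Fin 3 ⊕ Fin 3, (MvPolynomial.X s * MvPolynomial.X s : MvPolynomial (Fin 3 ⊕ Fin 3) ℚ).totalDegree ≤ 2 :=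
    fun s => (MvPolynomial.totalDegree_mul _ _).trans (by rw [MvPolynomial.totalDegree_X])
  have hX : ∀ s : Fin 3 ⊕ Fin 3, (MvPolynomial.X s : MvPolynomial (Fin 3 ⊕ Fin 3) ℚ).totalDegree ≤ 2 :=
    fun s => by rw [MvPolynomial.totalDegree_X]; norm_num
  have hmon : ∀ s : Fin 3 ⊕ Fin 3, (MvPolynomial.X s * MvPolynomial.X s : MvPolynomial (Fin 3 ⊕ Fin 3) ℚ) =
      MvPolynomial.monomial (Finsupp.single s 2) 1 := fun s => by
    rw [← sq, MvPolynomial.X_pow_eq_monomial]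
  refine max_le ?_ (Finset.sup_le fun m _ => ?_)
  · fin_cases i
    · simp only [gW, Fin.zero_eta, Matrix.cons_val_zero]
      exact (MvPolynomial.totalDegree_sub _ _).trans
        (max_le ((MvPolynomial.totalDegree_sub _ _).trans (max_le (hXX _) (hXX _))) (hXX _))
    · simp only [gW, Fin.mk_one, Matrix.cons_val_one, Matrix.cons_val_zero]
      exact (MvPolynomial.totalDegree_add _ _).trans (max_le (hXX _) (hXX _))
    · simp only [gW, Fin.reduceFinMk, Matrix.cons_val]
      exact (MvPolynomial.totalDegree_sub _ _).trans
        (max_le ((MvPolynomial.totalDegree_sub _ _).trans (max_le (hX _) (hX _)))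
          (by rw [MvPolynomial.totalDegree_one]; norm_num))
  · fin_cases i
    · simp only [gW, Fin.zero_eta, Matrix.cons_val_zero, hmon, MvPolynomial.coeff_sub, MvPolynomial.coeff_monomial]
      split_ifs <;> norm_num [Rat.num_neg_eq_neg_num, Rat.den_neg_eq_den]
    · simp only [gW, Fin.mk_one, Matrix.cons_val_one, Matrix.cons_val_zero, hmon, MvPolynomial.coeff_add,
        MvPolynomial.coeff_monomial]
      split_ifs <;> norm_num [Rat.num_neg_eq_neg_num, Rat.den_neg_eq_den]
    · simp only [gW, Fin.reduceFinMk, Matrix.cons_val, MvPolynomial.coeff_sub, MvPolynomial.coeff_X, MvPolynomial.coeff_one]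
      split_ifs <;> norm_num [Rat.num_neg_eq_neg_num, Rat.den_neg_eq_den]

/-- `‖W₃‖ ≤ 16` (sup norm; `a₀ < 4`, `√2 < 2`). -/
theorem norm_W₃_le : ‖W₃‖ ≤ ((4 ^ 2 : ℕ) : ℝ) := by
  have ha : ‖(a₀ : ℂ)‖ = a₀ := by rw [Complex.norm_real, Real.norm_eq_abs, abs_of_pos a₀_pos]
  have hs : Real.sqrt 2 < 2 := by
    rw [show (2 : ℝ) = Real.sqrt 4 by rw [show (4 : ℝ) = 2 ^ 2 by norm_num, Real.sqrt_sq (by norm_num : (0:ℝ) ≤ 2)]]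
    exact Real.sqrt_lt_sqrt (by norm_num) (by norm_num)
  have hrt : ‖rt2‖ = Real.sqrt 2 := by
    rw [rt2, Complex.norm_real, Real.norm_eq_abs, abs_of_nonneg (Real.sqrt_nonneg 2)]
  have h4 := a₀_spec.1.2
  have h0 := a₀_pos
  rw [pi_norm_le_iff_of_nonneg (by positivity)]
  intro j
  fin_cases j
  · rw [show ((fun i => i) ⟨0, by norm_num⟩ : Fin 3) = 0 from rfl, W₃_zero, ha]; push_cast; linarith
  · rw [show ((fun i => i) ⟨1, by norm_num⟩ : Fin 3) = 1 from rfl, W₃_one, norm_mul, ha, hrt]; push_cast; nlinarith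
  · rw [show ((fun i => i) ⟨2, by norm_num⟩ : Fin 3) = 2 from rfl, W₃_two, norm_mul, Complex.norm_I, ha]; push_cast; linarith

/-- **STAR-PRESENTABILITY.**  `W₃` satisfies the first inline hypothesis of `BridgeTransverse` (with `n = 3`) at its own optimal
complexity `c⋆`: a rational Khovanskii system of complexity `≤ c⋆` vanishing at `(W₃, e^{W₃})` with non-zero exponential Jacobian and
`‖W₃‖ ≤ 4^{c⋆}`, and none at any smaller complexity. -/
theorem starPresentable_W₃ : ∃ c : ℕ,
    (∃ g : Fin 3 → MvPolynomial (Fin 3 ⊕ Fin 3) ℚ,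
      (∀ i, max (g i).totalDegree ((g i).support.sup fun m => max ((g i).coeff m).num.natAbs ((g i).coeff m).den) ≤ c) ∧
      (∀ i, MvPolynomial.aeval (Sum.elim W₃ (Complex.exp ∘ W₃)) (g i) = 0) ∧
      (Matrix.of fun i j => MvPolynomial.aeval (Sum.elim W₃ (Complex.exp ∘ W₃)) (Khovanskii.ePD j (g i))).det ≠ 0 ∧
      ‖W₃‖ ≤ ((4 ^ c : ℕ) : ℝ)) ∧
    ∀ c' < c, ¬ (∃ g : Fin 3 → MvPolynomial (Fin 3 ⊕ Fin 3) ℚ,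
      (∀ i, max (g i).totalDegree ((g i).support.sup fun m => max ((g i).coeff m).num.natAbs ((g i).coeff m).den) ≤ c') ∧
      (∀ i, MvPolynomial.aeval (Sum.elim W₃ (Complex.exp ∘ W₃)) (g i) = 0) ∧
      (Matrix.of fun i j => MvPolynomial.aeval (Sum.elim W₃ (Complex.exp ∘ W₃)) (Khovanskii.ePD j (g i))).det ≠ 0 ∧
      ‖W₃‖ ≤ ((4 ^ c' : ℕ) : ℝ)) := by
  classical
  let P : ℕ → Prop := fun c => ∃ g : Fin 3 → MvPolynomial (Fin 3 ⊕ Fin 3) ℚ,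
      (∀ i, max (g i).totalDegree ((g i).support.sup fun m => max ((g i).coeff m).num.natAbs ((g i).coeff m).den) ≤ c) ∧
      (∀ i, MvPolynomial.aeval (Sum.elim W₃ (Complex.exp ∘ W₃)) (g i) = 0) ∧
      (Matrix.of fun i j => MvPolynomial.aeval (Sum.elim W₃ (Complex.exp ∘ W₃)) (Khovanskii.ePD j (g i))).det ≠ 0 ∧
      ‖W₃‖ ≤ ((4 ^ c : ℕ) : ℝ)
  have hP : ∃ c, P c := ⟨2, gW ℚ, complexity_gW, aeval_gW, by
    rw [det_jacobian_gW]
    exact mul_ne_zero (mul_ne_zero (mul_ne_zero (by norm_num) Complex.I_ne_zero) (pow_ne_zero 2 a₀_ne_zero)) key_ne_zero,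
    norm_W₃_le⟩
  exact ⟨Nat.find hP, Nat.find_spec hP, fun c' hc' => Nat.find_min hP hc'⟩

/-! ## 10. The wall in tower form: unconditional transversality is an open rank-two instance -/

/-- `Fin.snoc (a₀) (√2·a₀) = (a₀, √2·a₀)`. -/
theorem snoc_one : (Fin.snoc ![(a₀ : ℂ)] (rt2 * a₀) : Fin 2 → ℂ) = ![(a₀ : ℂ), rt2 * a₀] := by
  ext j; fin_cases j <;> rfl

/-- `Fin.snoc (a₀, √2·a₀) (i·a₀) = W₃`. -/
theorem snoc_two : (Fin.snoc ![(a₀ : ℂ), rt2 * a₀] (I * a₀) : Fin 3 → ℂ) = W₃ := by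
  ext j; fin_cases j <;> rfl

/-- One storey: adjoining a Baker-type pair `(β·l, e^{β l})` (`β` algebraic, `l` in the field) raises `trdeg` by at most one. -/
theorem storey_bound {S : Set ℂ} {k : ℕ}
    (hS : Algebra.trdeg ℚ ↥(IntermediateField.adjoin ℚ S) ≤ (k : Cardinal)) {β l : ℂ} (hβ : IsAlgebraic ℚ β)
    (hl : l ∈ IntermediateField.adjoin ℚ S) :
    Algebra.trdeg ℚ ↥(IntermediateField.adjoin ℚ (S ∪ ({β * l, cexp (β * l)} : Set ℂ))) ≤ ((k + 1 : ℕ) : Cardinal) := by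
  rw [Nat.cast_add_one]
  exact (trdeg_adjoin_pair_le_of_baker hβ hl).trans (add_le_add hS le_rfl)

/-- If `trdeg ℚ(a₀, e^{a₀}) ≤ 1` then `W₃ = (a₀, √2·a₀, i·a₀)` is itself a `ℚ`-free tower tuple. -/
theorem towerTuple_W₃_of_trdeg_le_one
    (h : Algebra.trdeg ℚ ↥(IntermediateField.adjoin ℚ ({(a₀ : ℂ), cexp a₀} : Set ℂ)) ≤ 1) : TowerTuple W₃ := by
  classical
  have T1 : TowerTuple ![(a₀ : ℂ)] := towerTuple_of_depthOne fun j => by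
    fin_cases j; simp only [Fin.zero_eta, Matrix.cons_val_zero]; exact h.trans (by norm_num)
  have T2 : TowerTuple ![(a₀ : ℂ), rt2 * a₀] := by
    rw [← snoc_one]
    exact towerTuple_snoc T1 (storey_bound (trdeg_le_of_towerTuple T1) isAlgebraic_rt2
      (IntermediateField.subset_adjoin ℚ _ (Or.inl ⟨0, rfl⟩)))
  rw [← snoc_two]
  exact towerTuple_snoc T2 (storey_bound (trdeg_le_of_towerTuple T2) isAlgebraic_I
    (IntermediateField.subset_adjoin ℚ _ (Or.inl ⟨0, rfl⟩)))

/-- **WALL (tower form).**  If `a₀, e^{a₀}` were algebraically dependent, `W₃` would lie in the tower hull (it would be a tower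
itself).  So an UNCONDITIONAL proof of `¬ InTowerHull W₃` contains a proof of the open rank-two Schanuel instance
`trdeg ℚ(a₀, e^{a₀}) = 2` (`a₀` is transcendental by Lindemann–Weierstrass, but nothing is known about `(a₀, e^{a₀})`); the
conditional transversality `not_inTowerHull_W₃_of_structural` is the honest form of F5 (ii). -/
theorem inTowerHull_W₃_of_trdeg_le_one
    (h : Algebra.trdeg ℚ ↥(IntermediateField.adjoin ℚ ({(a₀ : ℂ), cexp a₀} : Set ℂ)) ≤ 1) : InTowerHull W₃ :=
  ⟨3, W₃, linearIndependent_W₃, towerTuple_W₃_of_trdeg_le_one h, fun j => Submodule.subset_span ⟨j, rfl⟩⟩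

/-- Contrapositive: transversality of `W₃` forces `trdeg ℚ(a₀, e^{a₀}) ≥ 2`. -/
theorem one_lt_trdeg_of_not_inTowerHull (h : ¬ InTowerHull W₃) :
    ¬ Algebra.trdeg ℚ ↥(IntermediateField.adjoin ℚ ({(a₀ : ℂ), cexp a₀} : Set ℂ)) ≤ 1 :=
  fun h1 => h (inTowerHull_W₃_of_trdeg_le_one h1)


end Summit.Schanuel.Schanuel.Theorems.RootDecomp1HWitness
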